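import Mathlib
import HarnessLib
import Summits.Ventures.LatticeQCDFlow.Exactness.FlowPushforward
import Summits.Ventures.LatticeQCDFlow.Exactness.SU2TorusAlcoveJacobian
import Summits.Ventures.LatticeQCDFlow.Exactness.JacobianRestrictDensity

/-!
# The stick-breaking chart of the `SU(3)` cell: `(α₀, α₁) ↦ (α₀, α₁(1 − α₀))` carries `(1 − α₀) · Leb` on the open box onto Lebesgue measure on the open simplex, and box flows become simplex flows with the booked chart correction

HONEST FRAMING: exact (Metropolis-corrected) sampling algorithms for lattice gauge theory;
figures of merit are autocorrelation/cost numbers at stated couplings and volumes; no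
continuum-physics claim.

Venture `LatticeQCDFlow` (cell pub-lqcd), topic `Exactness`; FANOUT row 10 (`eng-equiv`, engine
`latflow.equiv` `spectral.phi` / `phi_inv`, eqs. (22)–(24) of Boyda et al., PRD 103 (2021) 074504:
`ρ₁ = α₁`, `ρ_i = α_i ∏_{j<i}(1 − α_j)`, `logdet = Σ_j (n−1−j) log(1 − α_j)`; for `SU(3)` the cell is
two-dimensional and `logdet dφ = log(1 − α₀)`).  NEW WORK of the cell over Mathlib's change-of-variables
theorem `map_withDensity_abs_det_fderiv_eq_addHaar` and this row's `hasJacobian_of_presentation_ae`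
(`SU2TorusAlcoveJacobian.lean`) / `HasJacobian.withDensity_of_pos_ae` (`JacobianRestrictDensity.lean`).
Nothing is cited as a fact; no number; no definition.  Step 3 of 3 towards the `N = 3` alcove
(steps 1, 2a: `TorusCubeChart.lean`, `TorusWallsNull.lean`, `TorusWeylSymmetry.lean`; step 2b — the alcove
is a fundamental domain — is NOT here).

## What is typed (`B = (0,1)²`, `Δ° = {ρ | 0 < ρ₀, 0 < ρ₁, ρ₀ + ρ₁ < 1}` in `Fin 2 → ℝ`;
`φ(α) = (α₀, α₁(1 − α₀))`)

* `hasFDerivAt_stickBreaking_two`, `det_stickBreakingDeriv_two` (`det dφ = 1 − α₀`),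
  `injOn_stickBreaking_two`, `image_stickBreaking_two` (`φ '' B = Δ°`);
* **`map_stickBreaking_two`** — `φ_* ((1 − α₀) · Leb|_B) = Leb|_{Δ°}`: the open box with the
  stick-breaking density PRESENTS Lebesgue measure on the open simplex;
* **`hasJacobian_simplex_of_boxFlow_two`** — a map `G` of the simplex intertwined with a box map `χ`
  (`G (φ α) = φ (χ α)` a.e. on `B`) that has `HasJacobian (Leb|_B) χ Jχ` (e.g. any sequence of box
  coupling layers, `BoxCouplingFlowJacobian.lean`), with
  `J_G (φ α) = (1 − (χ α)₀) · Jχ α / (1 − α₀)` a.e., has `HasJacobian (Leb|_{Δ°}) G J_G` — the booked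
  `ld_chi + ld_phi_out − ld_phi_in` of `spectral_kernel` for `N = 3` is an exact Jacobian on the cell.

NOT here: `N ≥ 4` (general stick-breaking), the affine map `ζ` to the eigen-phase simplex (constant
Jacobian), step 2b; any number.
-/

noncomputable section

namespace Summit.Ventures.LatticeQCDFlow.Exactness

open MeasureTheory Set
open scoped ENNReal

/-! ## The stick-breaking map on `Fin 2 → ℝ` -/

/-- **Derivative of `φ(α) = (α₀, α₁(1 − α₀))`**: the linear map with rows `(1, 0)` and `(−α₁, 1 − α₀)`. -/
theorem hasFDerivAt_stickBreaking_two (α : Fin 2 → ℝ) :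
    HasFDerivAt (fun a : Fin 2 → ℝ => (![a 0, a 1 * (1 - a 0)] : Fin 2 → ℝ))
      (ContinuousLinearMap.pi ![ContinuousLinearMap.proj (R := ℝ) (φ := fun _ : Fin 2 => ℝ) 0,
        α 1 • (-ContinuousLinearMap.proj (R := ℝ) (φ := fun _ : Fin 2 => ℝ) 0) +
          (1 - α 0) • ContinuousLinearMap.proj (R := ℝ) (φ := fun _ : Fin 2 => ℝ) 1]) α := by
  rw [hasFDerivAt_pi']
  intro i
  rw [ContinuousLinearMap.proj_pi]
  fin_cases i
  · simp only [Fin.zero_eta, Matrix.cons_val_zero]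
    exact hasFDerivAt_apply 0 α
  · simp only [Fin.mk_one, Matrix.cons_val_one, Matrix.cons_val_zero]
    have h0 : HasFDerivAt (fun a : Fin 2 → ℝ => a 0)
        (ContinuousLinearMap.proj (R := ℝ) (φ := fun _ : Fin 2 => ℝ) 0) α := hasFDerivAt_apply 0 α
    have h1 : HasFDerivAt (fun a : Fin 2 → ℝ => a 1)
        (ContinuousLinearMap.proj (R := ℝ) (φ := fun _ : Fin 2 => ℝ) 1) α := hasFDerivAt_apply 1 α
    have h2 : HasFDerivAt (fun a : Fin 2 → ℝ => 1 - a 0)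
        (-ContinuousLinearMap.proj (R := ℝ) (φ := fun _ : Fin 2 => ℝ) 0) α := by
      simpa using h0.const_sub 1
    exact h1.mul h2

/-- **`det dφ(α) = 1 − α₀`.** -/
theorem det_stickBreakingDeriv_two (α : Fin 2 → ℝ) :
    (ContinuousLinearMap.pi ![ContinuousLinearMap.proj (R := ℝ) (φ := fun _ : Fin 2 => ℝ) 0,
        α 1 • (-ContinuousLinearMap.proj (R := ℝ) (φ := fun _ : Fin 2 => ℝ) 0) +
          (1 - α 0) • ContinuousLinearMap.proj (R := ℝ) (φ := fun _ : Fin 2 => ℝ) 1]).det = 1 - α 0 := by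
  rw [ContinuousLinearMap.det, ← LinearMap.det_toMatrix', Matrix.det_fin_two]
  simp [LinearMap.toMatrix'_apply]

/-- **`φ` is injective on the open box.** -/
theorem injOn_stickBreaking_two :
    InjOn (fun a : Fin 2 → ℝ => (![a 0, a 1 * (1 - a 0)] : Fin 2 → ℝ))
      (Set.pi univ fun _ : Fin 2 => Ioo (0 : ℝ) 1) := by
  intro a ha b hb hab
  have ha0 := ha 0 (mem_univ _)
  have h0 : a 0 = b 0 := by
    have := congr_fun hab 0
    simpa using this
  have h1 : a 1 * (1 - a 0) = b 1 * (1 - b 0) := by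
    have := congr_fun hab 1
    simpa using this
  rw [h0] at h1
  have hne : 1 - b 0 ≠ 0 := by rw [← h0]; linarith [ha0.2]
  have h1' : a 1 = b 1 := mul_right_cancel₀ hne h1
  funext i
  fin_cases i
  · exact h0
  · exact h1'

/-- **The image of the open box is the open simplex** `{0 < ρ₀, 0 < ρ₁, ρ₀ + ρ₁ < 1}`. -/
theorem image_stickBreaking_two :
    (fun a : Fin 2 → ℝ => (![a 0, a 1 * (1 - a 0)] : Fin 2 → ℝ)) '' (Set.pi univ fun _ : Fin 2 => Ioo (0 : ℝ) 1) =
      {ρ : Fin 2 → ℝ | 0 < ρ 0 ∧ 0 < ρ 1 ∧ ρ 0 + ρ 1 < 1} := by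
  ext ρ
  constructor
  · rintro ⟨a, ha, rfl⟩
    have h0 := ha 0 (mem_univ _)
    have h1 := ha 1 (mem_univ _)
    simp only [mem_setOf_eq, Matrix.cons_val_zero, Matrix.cons_val_one]
    refine ⟨h0.1, mul_pos h1.1 (by linarith [h0.2]), ?_⟩
    nlinarith [h0.1, h0.2, h1.1, h1.2]
  · rintro ⟨h0, h1, hs⟩
    refine ⟨![ρ 0, ρ 1 / (1 - ρ 0)], fun i _ => ?_, ?_⟩
    · fin_cases i
      · simp only [Fin.zero_eta, Matrix.cons_val_zero]
        exact ⟨h0, by linarith⟩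
      · simp only [Fin.mk_one, Matrix.cons_val_one, Matrix.cons_val_zero]
        have hden : 0 < 1 - ρ 0 := by linarith
        exact ⟨div_pos h1 hden, (div_lt_one hden).mpr (by linarith)⟩
    · funext i
      fin_cases i
      · simp
      · simp only [Fin.mk_one, Matrix.cons_val_one, Matrix.cons_val_zero]
        have hden : 1 - ρ 0 ≠ 0 := by linarith
        field_simp

/-- The open box is measurable. -/
theorem measurableSet_openBox_two : MeasurableSet (Set.pi univ fun _ : Fin 2 => Ioo (0 : ℝ) 1) :=
  MeasurableSet.univ_pi fun _ => measurableSet_Ioo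

/-- **The stick-breaking chart presents Lebesgue measure on the open simplex**:
`φ_* ((1 − α₀) · Leb|_B) = Leb|_{Δ°}` (change of variables, `|det dφ| = 1 − α₀` on `B`). -/
theorem map_stickBreaking_two :
    Measure.map (fun a : Fin 2 → ℝ => (![a 0, a 1 * (1 - a 0)] : Fin 2 → ℝ))
      ((volume.restrict (Set.pi univ fun _ : Fin 2 => Ioo (0 : ℝ) 1)).withDensity
        fun a => ENNReal.ofReal |1 - a 0|) =
      volume.restrict {ρ : Fin 2 → ℝ | 0 < ρ 0 ∧ 0 < ρ 1 ∧ ρ 0 + ρ 1 < 1} := by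
  have h := map_withDensity_abs_det_fderiv_eq_addHaar (volume : Measure (Fin 2 → ℝ))
    measurableSet_openBox_two.nullMeasurableSet
    (fun a _ => (hasFDerivAt_stickBreaking_two a).hasFDerivWithinAt) injOn_stickBreaking_two
  simp_rw [det_stickBreakingDeriv_two] at h
  rw [image_stickBreaking_two] at h
  exact h

/-- **Box flows become simplex flows with the booked chart correction.**  Let `χ` have
`HasJacobian (Leb|_B) χ Jχ` on the open box `B = (0,1)²`, let `G` (measurable) satisfy
`G (φ α) = φ (χ α)` for a.e. `α ∈ B`, and let `J_G` (measurable) satisfy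
`J_G (φ α) = (1 − (χ α)₀) · Jχ α / (1 − α₀)` for a.e. `α ∈ B`.  Then `HasJacobian (Leb|_{Δ°}) G J_G`:
on the `SU(3)` cell the engine's `ld_chi + ld_phi_out − ld_phi_in` is an exact log-Jacobian. -/
theorem hasJacobian_simplex_of_boxFlow_two {χ : (Fin 2 → ℝ) → (Fin 2 → ℝ)} {Jχ : (Fin 2 → ℝ) → ℝ≥0∞}
    (hχ : HasJacobian (volume.restrict (Set.pi univ fun _ : Fin 2 => Ioo (0 : ℝ) 1)) χ Jχ)
    {G : (Fin 2 → ℝ) → (Fin 2 → ℝ)} (hG : Measurable G) {JG : (Fin 2 → ℝ) → ℝ≥0∞} (hJG : Measurable JG)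
    (hcomm : ∀ᵐ a ∂(volume.restrict (Set.pi univ fun _ : Fin 2 => Ioo (0 : ℝ) 1)),
      G (![a 0, a 1 * (1 - a 0)]) = ![(χ a) 0, (χ a) 1 * (1 - (χ a) 0)])
    (hJ : ∀ᵐ a ∂(volume.restrict (Set.pi univ fun _ : Fin 2 => Ioo (0 : ℝ) 1)),
      JG (![a 0, a 1 * (1 - a 0)]) = ENNReal.ofReal |1 - (χ a) 0| * Jχ a / ENNReal.ofReal |1 - a 0|) :
    HasJacobian (volume.restrict {ρ : Fin 2 → ℝ | 0 < ρ 0 ∧ 0 < ρ 1 ∧ ρ 0 + ρ 1 < 1}) G JG := by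
  have hDm : Measurable fun a : Fin 2 → ℝ => ENNReal.ofReal |1 - a 0| :=
    ENNReal.measurable_ofReal.comp ((measurable_const.sub (measurable_pi_apply 0)).abs)
  -- on the box the density is positive and finite
  have hD0 : ∀ᵐ a ∂(volume.restrict (Set.pi univ fun _ : Fin 2 => Ioo (0 : ℝ) 1)),
      ENNReal.ofReal |1 - a 0| ≠ 0 := by
    refine (ae_restrict_iff' measurableSet_openBox_two).mpr (Filter.Eventually.of_forall fun a ha => ?_)
    have h0 := ha 0 (mem_univ _)
    rw [ENNReal.ofReal_ne_zero_iff]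
    exact abs_pos.mpr (by linarith [h0.2])
  have hDtop : ∀ᵐ a ∂(volume.restrict (Set.pi univ fun _ : Fin 2 => Ioo (0 : ℝ) 1)),
      ENNReal.ofReal |1 - a 0| ≠ ∞ := Filter.Eventually.of_forall fun a => ENNReal.ofReal_ne_top
  -- the box flow against the chart density
  have hχ' := hχ.withDensity_of_pos_ae hDm hD0 hDtop
  -- transport along the chart
  have hφm : Measurable fun a : Fin 2 → ℝ => (![a 0, a 1 * (1 - a 0)] : Fin 2 → ℝ) :=
    (continuous_pi fun i => by
      fin_cases i
      · exact continuous_apply 0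
      · exact (continuous_apply 1).mul (continuous_const.sub (continuous_apply 0))).measurable
  refine hasJacobian_of_presentation_ae hφm map_stickBreaking_two hχ' hG hJG ?_ ?_
  · exact (withDensity_absolutelyContinuous _ _) hcomm
  · exact (withDensity_absolutelyContinuous _ _) hJ

end Summit.Ventures.LatticeQCDFlow.Exactness
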